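import Summits.FinalStateConjecture.FinalStateConjecture.Theorems.PhotonSphereChannelsExteriorEnergyRW

/-!
# Route PhotonSphereChannels — the general first-order multiplier identity for `u_tt − u_xx + V u = 0`
# (Morawetz / Lagrangian currents) and its integrated form on rectangles

Helper file for the registered sub-goal `stub_rwLocalEnergyDecay` (integrated local energy decay, ILED) of
stub `stub_outgoingEnergyExhaustion` (H4) of line `isolated-kerr-connected-hull` (crux
stmt-FinalStateConjecture-14075).  For a `C²` solution `u` of `u_tt − u_xx + V u = 0` on `ℝ × ℝ` with `V`
CONTINUOUS, and three differentiable weights `f, β, φ : ℝ → ℝ` of the space variable with continuous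
derivatives `f′, β′, φ′` (passed as functions with `HasDerivAt` hypotheses — no `ContDiff` bookkeeping), the
current
`P = u_t (f u_x + β u)`, `Q = ½ f (u_t² + u_x²) + β u u_x − φ u²`
satisfies the pointwise **multiplier identity** (`fderiv_multiplierP_sub`)
`∂ₜ P − ∂ₓ Q = −B`,
`B = (½ f′ − β) u_t² + (½ f′ + β) u_x² + (β′ + f V − 2 φ) u u_x + (β V − φ′) u²`
(multiply the equation by `f u_x + β u`; the free function `φ` records how much of the cross term is
integrated by parts).  `β = ½ f′` is the Morawetz (virial) current, `f = 0, β = −h` the Lagrangian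
(equipartition) current.  No third derivative of `f` and no derivative of `V` occur.  Green's formula on a
rectangle `[t₁, t₂] × [x₁, x₂]` (Mathlib's `integral2_divergence_prod_of_hasFDerivAt`) gives the integrated form
(`multiplier_identity_rect`):
`∫_A^B P(t₂,·) − ∫_A^B P(t₁,·) + ∫_{t₁}^{t₂} ∫_A^B B = ∫_{t₁}^{t₂} Q(·,B) − ∫_{t₁}^{t₂} Q(·,A)`.
Densities are passed as functions with defining hypotheses (`hP`, `hQ`, `hB`), as in
`WaveEnergy.energy_identity_affine`.  Standard material [folklore].
-/

namespace Summit.FinalStateConjecture.FinalStateConjecture.Theorems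

-- every `Summit.FinalStateConjecture.FinalStateConjecture.…` name repeats the summit = sub-problem
-- segment (D-0017 layout), as in every landed `…Theorems` file of this route
set_option linter.dupNamespace false

open MeasureTheory Set Filter Topology intervalIntegral

noncomputable section

namespace WaveEnergy

variable {u : ℝ × ℝ → ℝ} {V : ℝ → ℝ} {f f' β β' φ φ' : ℝ → ℝ}

/-- The multiplier current `P = u_t (f u_x + β u)` (hypothesis `hP`) is differentiable on `ℝ × ℝ`
(`u ∈ C²`, `f, β` differentiable). -/
theorem differentiable_multiplierP (hu : ContDiff ℝ 2 u) (hf : ∀ x, HasDerivAt f (f' x) x)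
    (hβ : ∀ x, HasDerivAt β (β' x) x) {P : ℝ × ℝ → ℝ}
    (hP : ∀ z, P z = fderiv ℝ u z (1, 0) * (f z.2 * fderiv ℝ u z (0, 1) + β z.2 * u z)) :
    Differentiable ℝ P := by
  have h1 := differentiable_fderiv_apply hu (1, 0)
  have h2 := differentiable_fderiv_apply hu (0, 1)
  have h3 := differentiable_of_contDiff_two hu
  have h4 : Differentiable ℝ (fun z : ℝ × ℝ => f z.2) :=
    (Differentiable.comp (fun x => (hf x).differentiableAt) differentiable_snd)
  have h5 : Differentiable ℝ (fun z : ℝ × ℝ => β z.2) :=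
    (Differentiable.comp (fun x => (hβ x).differentiableAt) differentiable_snd)
  have : P = fun z => fderiv ℝ u z (1, 0) * (f z.2 * fderiv ℝ u z (0, 1) + β z.2 * u z) := funext hP
  rw [this]
  exact h1.mul ((h4.mul h2).add (h5.mul h3))

/-- The multiplier flux `Q = ½ f (u_t² + u_x²) + β u u_x − φ u²` (hypothesis `hQ`) is differentiable on
`ℝ × ℝ` (`u ∈ C²`, `f, β, φ` differentiable). -/
theorem differentiable_multiplierQ (hu : ContDiff ℝ 2 u) (hf : ∀ x, HasDerivAt f (f' x) x)
    (hβ : ∀ x, HasDerivAt β (β' x) x) (hφ : ∀ x, HasDerivAt φ (φ' x) x) {Q : ℝ × ℝ → ℝ}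
    (hQ : ∀ z, Q z = 1 / 2 * f z.2 * (fderiv ℝ u z (1, 0) ^ 2 + fderiv ℝ u z (0, 1) ^ 2)
      + β z.2 * (u z * fderiv ℝ u z (0, 1)) - φ z.2 * u z ^ 2) :
    Differentiable ℝ Q := by
  have h1 := differentiable_fderiv_apply hu (1, 0)
  have h2 := differentiable_fderiv_apply hu (0, 1)
  have h3 := differentiable_of_contDiff_two hu
  have h4 : Differentiable ℝ (fun z : ℝ × ℝ => f z.2) :=
    (Differentiable.comp (fun x => (hf x).differentiableAt) differentiable_snd)
  have h5 : Differentiable ℝ (fun z : ℝ × ℝ => β z.2) :=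
    (Differentiable.comp (fun x => (hβ x).differentiableAt) differentiable_snd)
  have h6 : Differentiable ℝ (fun z : ℝ × ℝ => φ z.2) :=
    (Differentiable.comp (fun x => (hφ x).differentiableAt) differentiable_snd)
  have : Q = fun z => 1 / 2 * f z.2 * (fderiv ℝ u z (1, 0) ^ 2 + fderiv ℝ u z (0, 1) ^ 2)
      + β z.2 * (u z * fderiv ℝ u z (0, 1)) - φ z.2 * u z ^ 2 := funext hQ
  rw [this]
  exact ((((differentiable_const _).mul h4).mul ((h1.pow 2).add (h2.pow 2))).add
    (h5.mul (h3.mul h2))).sub (h6.mul (h3.pow 2))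

/-- The multiplier bulk `B = (½f′ − β) u_t² + (½f′ + β) u_x² + (β′ + fV − 2φ) u u_x + (βV − φ′) u²`
(hypothesis `hB`) is continuous (`u ∈ C²`; `V, f, β, φ, f′, β′, φ′` continuous). -/
theorem continuous_multiplierBulk (hu : ContDiff ℝ 2 u) (hV : Continuous V)
    (hf : ∀ x, HasDerivAt f (f' x) x) (hβ : ∀ x, HasDerivAt β (β' x) x)
    (hφ : ∀ x, HasDerivAt φ (φ' x) x) (hf'c : Continuous f') (hβ'c : Continuous β')
    (hφ'c : Continuous φ') {Bk : ℝ × ℝ → ℝ}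
    (hB : ∀ z, Bk z = (1 / 2 * f' z.2 - β z.2) * fderiv ℝ u z (1, 0) ^ 2
      + (1 / 2 * f' z.2 + β z.2) * fderiv ℝ u z (0, 1) ^ 2
      + (β' z.2 + f z.2 * V z.2 - 2 * φ z.2) * (u z * fderiv ℝ u z (0, 1))
      + (β z.2 * V z.2 - φ' z.2) * u z ^ 2) :
    Continuous Bk := by
  have h1 := continuous_fderiv_apply hu (1, 0)
  have h2 := continuous_fderiv_apply hu (0, 1)
  have h3 := (differentiable_of_contDiff_two hu).continuous
  have hfc : Continuous (fun z : ℝ × ℝ => f z.2) :=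
    (Differentiable.continuous fun x => (hf x).differentiableAt).comp continuous_snd
  have hβc : Continuous (fun z : ℝ × ℝ => β z.2) :=
    (Differentiable.continuous fun x => (hβ x).differentiableAt).comp continuous_snd
  have hφc : Continuous (fun z : ℝ × ℝ => φ z.2) :=
    (Differentiable.continuous fun x => (hφ x).differentiableAt).comp continuous_snd
  have hf'c2 : Continuous (fun z : ℝ × ℝ => f' z.2) := hf'c.comp continuous_snd
  have hβ'c2 : Continuous (fun z : ℝ × ℝ => β' z.2) := hβ'c.comp continuous_snd
  have hφ'c2 : Continuous (fun z : ℝ × ℝ => φ' z.2) := hφ'c.comp continuous_snd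
  have hVc : Continuous (fun z : ℝ × ℝ => V z.2) := hV.comp continuous_snd
  have : Bk = fun z => (1 / 2 * f' z.2 - β z.2) * fderiv ℝ u z (1, 0) ^ 2
      + (1 / 2 * f' z.2 + β z.2) * fderiv ℝ u z (0, 1) ^ 2
      + (β' z.2 + f z.2 * V z.2 - 2 * φ z.2) * (u z * fderiv ℝ u z (0, 1))
      + (β z.2 * V z.2 - φ' z.2) * u z ^ 2 := funext hB
  rw [this]
  exact (((((hf'c2.const_mul _).sub hβc).mul (h1.pow 2)).add (((hf'c2.const_mul _).add hβc).mul
    (h2.pow 2))).add (((hβ'c2.add (hfc.mul hVc)).sub (hφc.const_mul _)).mul (h3.mul h2))).add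
    (((hβc.mul hVc).sub hφ'c2).mul (h3.pow 2))

/-- `∂ₜ P` along a `t`-slice: `τ ↦ P (τ, x)` has derivative `u_tt (f u_x + β u) + u_t (f u_xt + β u_t)`
(second partials as `∂²u (1,0) (·)`). -/
theorem hasDerivAt_multiplierP_slice_fst (hu : ContDiff ℝ 2 u) {P : ℝ × ℝ → ℝ}
    (hP : ∀ z, P z = fderiv ℝ u z (1, 0) * (f z.2 * fderiv ℝ u z (0, 1) + β z.2 * u z))
    (t x : ℝ) :
    HasDerivAt (fun τ => P (τ, x))
      (fderiv ℝ (fderiv ℝ u) (t, x) (1, 0) (1, 0) * (f x * fderiv ℝ u (t, x) (0, 1) + β x * u (t, x))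
        + fderiv ℝ u (t, x) (1, 0) * (f x * fderiv ℝ (fderiv ℝ u) (t, x) (1, 0) (0, 1)
          + β x * fderiv ℝ u (t, x) (1, 0))) t := by
  have h1 := hasDerivAt_fderiv_apply_slice_fst hu (1, 0) t x
  have h2 := hasDerivAt_fderiv_apply_slice_fst hu (0, 1) t x
  have h3 := hasDerivAt_slice_fst (differentiable_of_contDiff_two hu) t x
  have h := h1.fun_mul ((h2.const_mul (f x)).fun_add (h3.const_mul (β x)))
  have hfun : (fun τ => P (τ, x)) = fun τ =>
      fderiv ℝ u (τ, x) (1, 0) * (f x * fderiv ℝ u (τ, x) (0, 1) + β x * u (τ, x)) :=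
    funext fun τ => hP (τ, x)
  rw [hfun]
  exact h.congr_deriv (by ring)

/-- `∂ₓ Q` along an `x`-slice: `y ↦ Q (t, y)` has derivative
`½ f′ (u_t² + u_x²) + f (u_t u_tx + u_x u_xx) + β′ u u_x + β (u_x² + u u_xx) − φ′ u² − 2 φ u u_x`
(second partials as `∂²u (0,1) (·)`). -/
theorem hasDerivAt_multiplierQ_slice_snd (hu : ContDiff ℝ 2 u) (hf : ∀ x, HasDerivAt f (f' x) x)
    (hβ : ∀ x, HasDerivAt β (β' x) x) (hφ : ∀ x, HasDerivAt φ (φ' x) x) {Q : ℝ × ℝ → ℝ}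
    (hQ : ∀ z, Q z = 1 / 2 * f z.2 * (fderiv ℝ u z (1, 0) ^ 2 + fderiv ℝ u z (0, 1) ^ 2)
      + β z.2 * (u z * fderiv ℝ u z (0, 1)) - φ z.2 * u z ^ 2) (t x : ℝ) :
    HasDerivAt (fun y => Q (t, y))
      (1 / 2 * f' x * (fderiv ℝ u (t, x) (1, 0) ^ 2 + fderiv ℝ u (t, x) (0, 1) ^ 2)
        + f x * (fderiv ℝ u (t, x) (1, 0) * fderiv ℝ (fderiv ℝ u) (t, x) (0, 1) (1, 0)
          + fderiv ℝ u (t, x) (0, 1) * fderiv ℝ (fderiv ℝ u) (t, x) (0, 1) (0, 1))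
        + β' x * (u (t, x) * fderiv ℝ u (t, x) (0, 1))
        + β x * (fderiv ℝ u (t, x) (0, 1) ^ 2 + u (t, x) * fderiv ℝ (fderiv ℝ u) (t, x) (0, 1) (0, 1))
        - φ' x * u (t, x) ^ 2 - 2 * φ x * (u (t, x) * fderiv ℝ u (t, x) (0, 1))) x := by
  have k1 := hasDerivAt_fderiv_apply_slice_snd hu (1, 0) t x
  have k2 := hasDerivAt_fderiv_apply_slice_snd hu (0, 1) t x
  have k3 := hasDerivAt_slice_snd (differentiable_of_contDiff_two hu) t x
  have h := ((((hf x).const_mul (1 / 2)).fun_mul ((k1.fun_pow 2).fun_add (k2.fun_pow 2))).fun_add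
    ((hβ x).fun_mul (k3.fun_mul k2))).fun_sub ((hφ x).fun_mul (k3.fun_pow 2))
  have hfun : (fun y => Q (t, y)) = fun y =>
      1 / 2 * f y * (fderiv ℝ u (t, y) (1, 0) ^ 2 + fderiv ℝ u (t, y) (0, 1) ^ 2)
        + β y * (u (t, y) * fderiv ℝ u (t, y) (0, 1)) - φ y * u (t, y) ^ 2 :=
    funext fun y => hQ (t, y)
  rw [hfun]
  refine h.congr_deriv ?_
  push_cast
  ring

/-- **The multiplier identity.** For a `C²` solution of `u_tt − u_xx + V u = 0` and differentiable weights
`f, β, φ` of `x`, `∂ₜ P − ∂ₓ Q = −B` pointwise, i.e. `∂P(z)(1,0) − ∂Q(z)(0,1) + B(z) = 0`, where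
`P = u_t (f u_x + β u)`, `Q = ½ f (u_t² + u_x²) + β u u_x − φ u²` and
`B = (½ f′ − β) u_t² + (½ f′ + β) u_x² + (β′ + f V − 2 φ) u u_x + (β V − φ′) u²`:
`∂ₜP − ∂ₓQ + B = (f u_x + β u)(u_tt − u_xx + V u) + f u_t (u_xt − u_tx) = 0`. [folklore] -/
theorem fderiv_multiplierP_sub (hu : ContDiff ℝ 2 u)
    (hsol : ∀ z : ℝ × ℝ, fderiv ℝ (fderiv ℝ u) z (1, 0) (1, 0)
      - fderiv ℝ (fderiv ℝ u) z (0, 1) (0, 1) + V z.2 * u z = 0)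
    (hf : ∀ x, HasDerivAt f (f' x) x) (hβ : ∀ x, HasDerivAt β (β' x) x)
    (hφ : ∀ x, HasDerivAt φ (φ' x) x) {P Q Bk : ℝ × ℝ → ℝ}
    (hP : ∀ z, P z = fderiv ℝ u z (1, 0) * (f z.2 * fderiv ℝ u z (0, 1) + β z.2 * u z))
    (hQ : ∀ z, Q z = 1 / 2 * f z.2 * (fderiv ℝ u z (1, 0) ^ 2 + fderiv ℝ u z (0, 1) ^ 2)
      + β z.2 * (u z * fderiv ℝ u z (0, 1)) - φ z.2 * u z ^ 2)
    (hB : ∀ z, Bk z = (1 / 2 * f' z.2 - β z.2) * fderiv ℝ u z (1, 0) ^ 2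
      + (1 / 2 * f' z.2 + β z.2) * fderiv ℝ u z (0, 1) ^ 2
      + (β' z.2 + f z.2 * V z.2 - 2 * φ z.2) * (u z * fderiv ℝ u z (0, 1))
      + (β z.2 * V z.2 - φ' z.2) * u z ^ 2) (z : ℝ × ℝ) :
    fderiv ℝ P z (1, 0) - fderiv ℝ Q z (0, 1) + Bk z = 0 := by
  obtain ⟨t, x⟩ := z
  have hE := (hasDerivAt_slice_fst (differentiable_multiplierP hu hf hβ hP) t x).unique
    (hasDerivAt_multiplierP_slice_fst hu hP t x)
  have hM := (hasDerivAt_slice_snd (differentiable_multiplierQ hu hf hβ hφ hQ) t x).unique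
    (hasDerivAt_multiplierQ_slice_snd hu hf hβ hφ hQ t x)
  rw [hE, hM, hB]
  have hsymm := fderiv_fderiv_symm hu (t, x) (1, 0) (0, 1)
  have hs := hsol (t, x)
  simp only at hs ⊢
  linear_combination (f x * fderiv ℝ u (t, x) (0, 1) + β x * u (t, x)) * hs
    + (f x * fderiv ℝ u (t, x) (1, 0)) * hsymm

/-- **The multiplier identity integrated over a rectangle** `[t₁, t₂] × [x₁, x₂]` (oriented interval
integrals, no ordering hypotheses): with `P, Q, B` as in `fderiv_multiplierP_sub` and `V`, `f′`, `β′`, `φ′`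
continuous,
`∫_A^B P(t₂,·) − ∫_A^B P(t₁,·) + ∫_{t₁}^{t₂} ∫_A^B B = ∫_{t₁}^{t₂} Q(·,B) − ∫_{t₁}^{t₂} Q(·,A)`.
Proof: Green's formula on the box for the pair `(P, −Q)`, whose divergence is `−B`. [folklore] -/
theorem multiplier_identity_rect (hu : ContDiff ℝ 2 u) (hV : Continuous V)
    (hsol : ∀ z : ℝ × ℝ, fderiv ℝ (fderiv ℝ u) z (1, 0) (1, 0)
      - fderiv ℝ (fderiv ℝ u) z (0, 1) (0, 1) + V z.2 * u z = 0)
    (hf : ∀ x, HasDerivAt f (f' x) x) (hβ : ∀ x, HasDerivAt β (β' x) x)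
    (hφ : ∀ x, HasDerivAt φ (φ' x) x) (hf'c : Continuous f') (hβ'c : Continuous β')
    (hφ'c : Continuous φ') {P Q Bk : ℝ × ℝ → ℝ}
    (hP : ∀ z, P z = fderiv ℝ u z (1, 0) * (f z.2 * fderiv ℝ u z (0, 1) + β z.2 * u z))
    (hQ : ∀ z, Q z = 1 / 2 * f z.2 * (fderiv ℝ u z (1, 0) ^ 2 + fderiv ℝ u z (0, 1) ^ 2)
      + β z.2 * (u z * fderiv ℝ u z (0, 1)) - φ z.2 * u z ^ 2)
    (hB : ∀ z, Bk z = (1 / 2 * f' z.2 - β z.2) * fderiv ℝ u z (1, 0) ^ 2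
      + (1 / 2 * f' z.2 + β z.2) * fderiv ℝ u z (0, 1) ^ 2
      + (β' z.2 + f z.2 * V z.2 - 2 * φ z.2) * (u z * fderiv ℝ u z (0, 1))
      + (β z.2 * V z.2 - φ' z.2) * u z ^ 2) (t₁ t₂ x₁ x₂ : ℝ) :
    (∫ x in x₁..x₂, P (t₂, x)) - (∫ x in x₁..x₂, P (t₁, x)) + ∫ t in t₁..t₂, ∫ x in x₁..x₂, Bk (t, x)
      = (∫ t in t₁..t₂, Q (t, x₂)) - ∫ t in t₁..t₂, Q (t, x₁) := by
  have hPd := differentiable_multiplierP hu hf hβ hP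
  have hQd := differentiable_multiplierQ hu hf hβ hφ hQ
  have hBc := continuous_multiplierBulk hu hV hf hβ hφ hf'c hβ'c hφ'c hB
  have hcons := fderiv_multiplierP_sub hu hsol hf hβ hφ hP hQ hB
  -- the pair `(P, −Q)` and its divergence `−B`
  set G : ℝ × ℝ → ℝ := fun z => -Q z with hG
  have hGd : Differentiable ℝ G := hQd.neg
  set G' : ℝ × ℝ → ℝ × ℝ →L[ℝ] ℝ := fun z => -fderiv ℝ Q z with hG'
  have hGd' : ∀ z, HasFDerivAt G (G' z) z := fun z => (hQd z).hasFDerivAt.neg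
  have hdiv : ∀ z : ℝ × ℝ, fderiv ℝ P z (1, 0) + G' z (0, 1) = -Bk z := by
    intro z
    show fderiv ℝ P z (1, 0) + -(fderiv ℝ Q z (0, 1)) = -Bk z
    linear_combination hcons z
  have hdivfun : (fun z : ℝ × ℝ => fderiv ℝ P z (1, 0) + G' z (0, 1)) = fun z => -Bk z :=
    funext hdiv
  have key := integral2_divergence_prod_of_hasFDerivAt P G (fderiv ℝ P) G' t₁ x₁ t₂ x₂
    hPd.continuous.continuousOn hGd.continuous.continuousOn
    (fun z _ => (hPd z).hasFDerivAt) (fun z _ => hGd' z)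
    (by
      rw [hdivfun]
      exact hBc.neg.continuousOn.integrableOn_compact (isCompact_uIcc.prod isCompact_uIcc))
  have hlhs : (∫ t in t₁..t₂, ∫ x in x₁..x₂, fderiv ℝ P (t, x) (1, 0) + G' (t, x) (0, 1))
      = -∫ t in t₁..t₂, ∫ x in x₁..x₂, Bk (t, x) := by
    simp_rw [hdiv]
    rw [← intervalIntegral.integral_neg]
    refine intervalIntegral.integral_congr fun t _ => ?_
    simp only [intervalIntegral.integral_neg]
  rw [hlhs] at key
  simp only [hG, intervalIntegral.integral_neg] at key
  linarith

/-- **Registered sub-goal `stub_rwMorawetzIdentity` of `stub_rwLocalEnergyDecay`** (crux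
stmt-FinalStateConjecture-14075, line `isolated-kerr-connected-hull`): the multiplier (Morawetz/Lagrangian)
identity for `C²` solutions of `u_tt − u_xx + V u = 0`, integrated over rectangles. [folklore] -/
theorem stub_rwMorawetzIdentity :
    ∀ (u : ℝ × ℝ → ℝ) (V : ℝ → ℝ), ContDiff ℝ 2 u → Continuous V →
      (∀ z : ℝ × ℝ, fderiv ℝ (fderiv ℝ u) z (1, 0) (1, 0)
        - fderiv ℝ (fderiv ℝ u) z (0, 1) (0, 1) + V z.2 * u z = 0) →
      ∀ (f f' β β' φ φ' : ℝ → ℝ), (∀ x, HasDerivAt f (f' x) x) → (∀ x, HasDerivAt β (β' x) x) →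
        (∀ x, HasDerivAt φ (φ' x) x) → Continuous f' → Continuous β' → Continuous φ' →
        ∀ (P Q Bk : ℝ × ℝ → ℝ),
          (∀ z, P z = fderiv ℝ u z (1, 0) * (f z.2 * fderiv ℝ u z (0, 1) + β z.2 * u z)) →
          (∀ z, Q z = 1 / 2 * f z.2 * (fderiv ℝ u z (1, 0) ^ 2 + fderiv ℝ u z (0, 1) ^ 2)
            + β z.2 * (u z * fderiv ℝ u z (0, 1)) - φ z.2 * u z ^ 2) →
          (∀ z, Bk z = (1 / 2 * f' z.2 - β z.2) * fderiv ℝ u z (1, 0) ^ 2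
            + (1 / 2 * f' z.2 + β z.2) * fderiv ℝ u z (0, 1) ^ 2
            + (β' z.2 + f z.2 * V z.2 - 2 * φ z.2) * (u z * fderiv ℝ u z (0, 1))
            + (β z.2 * V z.2 - φ' z.2) * u z ^ 2) →
          ∀ (t₁ t₂ x₁ x₂ : ℝ),
            (∫ x in x₁..x₂, P (t₂, x)) - (∫ x in x₁..x₂, P (t₁, x)) + ∫ t in t₁..t₂, ∫ x in x₁..x₂, Bk (t, x)
              = (∫ t in t₁..t₂, Q (t, x₂)) - ∫ t in t₁..t₂, Q (t, x₁) :=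
  fun _ _ hu hV hsol _ _ _ _ _ _ hf hβ hφ hf'c hβ'c hφ'c _ _ _ hP hQ hB ↦
    multiplier_identity_rect hu hV hsol hf hβ hφ hf'c hβ'c hφ'c hP hQ hB

end WaveEnergy

end

end Summit.FinalStateConjecture.FinalStateConjecture.Theorems
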